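import Literature.Analysis.FluidPDE.HardSphereDynamics
import HarnessLib

/-!
# Hard-sphere trajectories: left limits, right-continuity, and time reversal (proofs)

`Literature.Analysis.FluidPDE.HardSphereDynamics` defines hard-sphere trajectories
(`Kinetic.IsHardSphereTrajectory`, GST 2013 Def. 4.1.2 / CIP 1994 §4.2) and records as a named
fact `Kinetic.IsHardSphereTrajectory.timeReverse` the reversibility of the dynamics (CIP 1994
§4.2, (2.3): the velocity flip of the left limits of `τ ↦ γ (-τ)` is again a hard-sphere
trajectory). This file proves that fact (`IsHardSphereTrajectory.timeReverse_holds`) and, on the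
way, the qualitative structure of a hard-sphere trajectory that the deterministic part of
Alexander's theorem (`Literature.Analysis.FluidPDE.HardSphereFlowConstruction`, facts
`torusFlow_group`, `torusFlow_isTrajectory`) will consume:

* `IsHardSphereTrajectory.exists_Ioo_left_free` / `exists_Ioo_right_free` — every time has a
  collision-free open interval immediately to its left and to its right (local finiteness);
* `IsHardSphereTrajectory.tendsto_nhdsLT`, `tendsto_leftLim`, `leftLim_eq_freeFlight`,
  `leftLim_eq_of_not_mem` — left limits exist everywhere and are free-flight values; away from
  collision times they are the values;
* `IsHardSphereTrajectory.tendsto_nhdsGT` — trajectories are right-continuous;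
  `tendsto_leftLim_nhdsGT` / `tendsto_leftLim_nhdsLT` — the left-limit function is
  left-continuous with right limits equal to the trajectory;
* `IsHardSphereTrajectory.leftLim_apply_fst`, `leftLim_mem`, `eq_collidePair_leftLim` —
  positions do not jump, left limits stay in the domain, and at a collision time the value is
  the elastic reflection of the (incoming) left limit;
* `Kinetic.collisionTimes_timeReverse` and **`IsHardSphereTrajectory.timeReverse_holds`**.
* `IsHardSphereTrajectory.configEnergy_eq_holds` — discharge of the named fact
  `IsHardSphereTrajectory.configEnergy_eq` (conservation of the kinetic energy: free flight keeps
  the velocities, elastic collisions keep `½ ∑ |v_i|²`, and by local finiteness of the collision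
  times the energy is locally constant in time, hence constant; GST 2013 §1.1, CIP 1994 §4.2);
* `HardSphereFlow.lawAt_withDensity_holds` — discharge of the named fact
  `HardSphereFlow.lawAt_withDensity` (mild Liouville equation: the law at time `t` of `W dZ` is
  `(W ∘ Φ_{-t}) dZ`, from the invariance of the Liouville measure; GST 2013 Prop. 4.1.1).

All statements assume what the fact assumes: a Hausdorff position space and continuity of each
translation `v ↦ x + v` (true for `ℝ^d` and `T^d`).

## References

* C. Cercignani, R. Illner, M. Pulvirenti, *The Mathematical Theory of Dilute Gases* (1994),
  §4.2, eq. (2.3) (`T^{-t} = S T^t S`).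
* I. Gallagher, L. Saint-Raymond, B. Texier, *From Newton to Boltzmann* (2013), §4.1.
-/

open Set Filter Topology Function

namespace Literature.Analysis.FluidPDE

noncomputable section

section Kinetic

variable {d : Type*} [Fintype d] {X : Type*} {N : ℕ}

/-! ## Predicates that only see positions -/

/-- Membership in the hard-sphere domain only depends on the positions. [folklore] -/
theorem mem_hardSphereDomain_congr_fst {G : Geometry d X} {ε : ℝ} {z z' : Config N d X}
    (h : ∀ i, (z i).1 = (z' i).1) :
    z ∈ hardSphereDomain G N ε ↔ z' ∈ hardSphereDomain G N ε := by
  simp only [mem_hardSphereDomain, h]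

/-- Membership in a contact set only depends on the positions. [folklore] -/
theorem mem_contactSet_congr_fst {G : Geometry d X} {ε : ℝ} {i j : Fin N} {z z' : Config N d X}
    (h : ∀ i, (z i).1 = (z' i).1) :
    z ∈ contactSet G N ε i j ↔ z' ∈ contactSet G N ε i j := by
  rw [mem_contactSet, mem_contactSet, mem_hardSphereDomain_congr_fst h, h i, h j]

/-- The velocity flip does not change contact. [folklore] -/
@[simp]
theorem flipVel_mem_contactSet_iff {G : Geometry d X} {ε : ℝ} {i j : Fin N} (z : Config N d X) :
    flipVel z ∈ contactSet G N ε i j ↔ z ∈ contactSet G N ε i j :=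
  mem_contactSet_congr_fst fun _ => rfl

/-- Free flight of a flipped free flight undoes it: `S_u (S (S_u y)) = S y` (CIP 1994 (2.3) for
the free flow: the velocity flip conjugates `S_u` to `S_{-u}`). [folklore] -/
theorem freeFlight_flipVel_freeFlight (G : Geometry d X) (u : ℝ) (y : Config N d X) :
    freeFlight G u (flipVel (freeFlight G u y)) = flipVel y := by
  funext i
  simp [smul_neg]

section Topology

variable [TopologicalSpace X]

/-- The velocity flip is continuous. [folklore] -/
theorem continuous_flipVel : Continuous (flipVel : Config N d X → Config N d X) := by
  unfold flipVel
  fun_prop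

/-- If each translation `v ↦ x + v` is continuous, free-flight orbits are continuous in time. [folklore] -/
theorem continuous_freeFlight_of_continuous_translate {G : Geometry d X}
    (hG : ∀ x : X, Continuous (G.translate x)) (z : Config N d X) :
    Continuous fun t : ℝ => freeFlight G t z := by
  refine continuous_pi fun i => ?_
  have h1 := hG (z i).1
  change Continuous fun t : ℝ => (G.translate (z i).1 (t • (z i).2), (z i).2)
  fun_prop

/-! ## Structure of a hard-sphere trajectory -/

namespace IsHardSphereTrajectory

variable {G : Geometry d X} {ε : ℝ} {γ : ℝ → Config N d X}

/-- Every time has a collision-free open interval immediately to its left (collision times are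
locally finite). [folklore] -/
theorem exists_Ioo_left_free (h : IsHardSphereTrajectory G ε N γ) (t : ℝ) :
    ∃ s < t, ∀ τ ∈ Ioo s t, τ ∉ collisionTimes G ε γ := by
  classical
  set F : Finset ℝ :=
    insert (t - 1) (((h.locFinite (t - 1) t).toFinset).filter fun x => x < t) with hF
  have hne : F.Nonempty := ⟨t - 1, Finset.mem_insert_self _ _⟩
  have hlow : t - 1 ≤ F.max' hne := Finset.le_max' F (t - 1) (Finset.mem_insert_self _ _)
  refine ⟨F.max' hne, ?_, ?_⟩
  · rw [Finset.max'_lt_iff]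
    intro y hy
    rcases Finset.mem_insert.1 hy with rfl | hy
    · linarith
    · exact (Finset.mem_filter.1 hy).2
  · intro τ hτ hcol
    have hτF : τ ∈ F := by
      refine Finset.mem_insert_of_mem (Finset.mem_filter.2 ⟨?_, hτ.2⟩)
      rw [Set.Finite.mem_toFinset]
      exact ⟨hcol, by linarith [hτ.1], hτ.2.le⟩
    exact (not_lt.2 (Finset.le_max' F τ hτF)) hτ.1

/-- Every time has a collision-free open interval immediately to its right. [folklore] -/
theorem exists_Ioo_right_free (h : IsHardSphereTrajectory G ε N γ) (t : ℝ) :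
    ∃ u > t, ∀ τ ∈ Ioo t u, τ ∉ collisionTimes G ε γ := by
  classical
  set F : Finset ℝ :=
    insert (t + 1) (((h.locFinite t (t + 1)).toFinset).filter fun x => t < x) with hF
  have hne : F.Nonempty := ⟨t + 1, Finset.mem_insert_self _ _⟩
  have hup : F.min' hne ≤ t + 1 := Finset.min'_le F (t + 1) (Finset.mem_insert_self _ _)
  refine ⟨F.min' hne, ?_, ?_⟩
  · rw [gt_iff_lt, Finset.lt_min'_iff]
    intro y hy
    rcases Finset.mem_insert.1 hy with rfl | hy
    · linarith
    · exact (Finset.mem_filter.1 hy).2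
  · intro τ hτ hcol
    have hτF : τ ∈ F := by
      refine Finset.mem_insert_of_mem (Finset.mem_filter.2 ⟨?_, hτ.1⟩)
      rw [Set.Finite.mem_toFinset]
      exact ⟨hcol, hτ.1.le, by linarith [hτ.2]⟩
    exact (not_lt.2 (Finset.min'_le F τ hτF)) hτ.2

/-- On `[s, t)` with `(s, t)` collision-free, the trajectory is free flight from `γ s`. [folklore] -/
theorem eq_freeFlight_of_Ioo_free (h : IsHardSphereTrajectory G ε N γ) {s t τ : ℝ}
    (hfree : ∀ σ ∈ Ioo s t, σ ∉ collisionTimes G ε γ) (hτ : τ ∈ Ico s t) :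
    γ τ = freeFlight G (τ - s) (γ s) :=
  h.free s τ hτ.1 fun σ hσ => hfree σ ⟨hσ.1, hσ.2.trans_lt hτ.2⟩

/-- Left limits: if `(s, t)` is collision-free then `γ τ → S_{t-s} (γ s)` as `τ ↑ t`. [folklore] -/
theorem tendsto_nhdsLT (h : IsHardSphereTrajectory G ε N γ)
    (hG : ∀ x : X, Continuous (G.translate x)) {s t : ℝ} (hst : s < t)
    (hfree : ∀ σ ∈ Ioo s t, σ ∉ collisionTimes G ε γ) :
    Tendsto γ (𝓝[<] t) (𝓝 (freeFlight G (t - s) (γ s))) := by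
  have hc : Continuous fun τ : ℝ => freeFlight G (τ - s) (γ s) := by
    have hff := continuous_freeFlight_of_continuous_translate hG (γ s)
    fun_prop
  refine ((hc.tendsto t).mono_left nhdsWithin_le_nhds).congr' ?_
  filter_upwards [Ioo_mem_nhdsLT hst] with τ hτ
  exact (h.eq_freeFlight_of_Ioo_free hfree ⟨hτ.1.le, hτ.2⟩).symm

/-- The left limit at `t` is the free-flight value from any `s < t` with `(s, t)`
collision-free. [folklore] -/
theorem leftLim_eq_freeFlight [T2Space X] (h : IsHardSphereTrajectory G ε N γ)
    (hG : ∀ x : X, Continuous (G.translate x)) {s t : ℝ} (hst : s < t)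
    (hfree : ∀ σ ∈ Ioo s t, σ ∉ collisionTimes G ε γ) :
    leftLim γ t = freeFlight G (t - s) (γ s) :=
  leftLim_eq_of_tendsto (h.tendsto_nhdsLT hG hst hfree)

/-- Hard-sphere trajectories have left limits everywhere. [folklore] -/
theorem tendsto_leftLim [T2Space X] (h : IsHardSphereTrajectory G ε N γ)
    (hG : ∀ x : X, Continuous (G.translate x)) (t : ℝ) :
    Tendsto γ (𝓝[<] t) (𝓝 (leftLim γ t)) := by
  obtain ⟨s, hst, hfree⟩ := h.exists_Ioo_left_free t
  rw [h.leftLim_eq_freeFlight hG hst hfree]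
  exact h.tendsto_nhdsLT hG hst hfree

/-- Away from collision times the left limit is the value. [folklore] -/
theorem leftLim_eq_of_not_mem [T2Space X] (h : IsHardSphereTrajectory G ε N γ)
    (hG : ∀ x : X, Continuous (G.translate x)) {t : ℝ} (ht : t ∉ collisionTimes G ε γ) :
    leftLim γ t = γ t := by
  obtain ⟨s, hst, hfree⟩ := h.exists_Ioo_left_free t
  rw [h.leftLim_eq_freeFlight hG hst hfree]
  refine (h.free s t hst.le fun σ hσ => ?_).symm
  rcases hσ.2.eq_or_lt with rfl | hlt
  · exact ht
  · exact hfree σ ⟨hσ.1, hlt⟩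

/-- Positions do not jump: the left limit has the same positions as the value. [folklore] -/
theorem leftLim_apply_fst [T2Space X] (h : IsHardSphereTrajectory G ε N γ)
    (hG : ∀ x : X, Continuous (G.translate x)) (t : ℝ) (i : Fin N) :
    (leftLim γ t i).1 = (γ t i).1 := by
  have hev : Continuous fun z : Config N d X => (z i).1 := by fun_prop
  have h1 : Tendsto (fun τ => (γ τ i).1) (𝓝[<] t) (𝓝 (leftLim γ t i).1) :=
    (hev.tendsto _).comp (h.tendsto_leftLim hG t)
  have h2 : Tendsto (fun τ => (γ τ i).1) (𝓝[<] t) (𝓝 (γ t i).1) :=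
    ((h.pos_continuous i).tendsto t).mono_left nhdsWithin_le_nhds
  exact tendsto_nhds_unique h1 h2

/-- Left limits stay in the hard-sphere domain. [folklore] -/
theorem leftLim_mem [T2Space X] (h : IsHardSphereTrajectory G ε N γ)
    (hG : ∀ x : X, Continuous (G.translate x)) (t : ℝ) :
    leftLim γ t ∈ hardSphereDomain G N ε :=
  (mem_hardSphereDomain_congr_fst (h.leftLim_apply_fst hG t)).2 (h.mem t)

/-- At a collision time the left limit is incoming for the colliding pair and the value is its
elastic reflection (the `binary` clause with the left limit made explicit). [folklore] -/
theorem eq_collidePair_leftLim [T2Space X] (h : IsHardSphereTrajectory G ε N γ)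
    {t : ℝ} {i j : Fin N} (hij : i ≠ j)
    (hc : γ t ∈ contactSet G N ε i j) :
    IsIncoming G (leftLim γ t) i j ∧ γ t = collidePair G i j (leftLim γ t) := by
  obtain ⟨-, zl, hzl, hin, heq⟩ := h.binary t i j hij hc
  rw [leftLim_eq_of_tendsto hzl]
  exact ⟨hin, heq⟩

/-- Hard-sphere trajectories are right-continuous. [folklore] -/
theorem tendsto_nhdsGT (h : IsHardSphereTrajectory G ε N γ)
    (hG : ∀ x : X, Continuous (G.translate x)) (t : ℝ) :
    Tendsto γ (𝓝[>] t) (𝓝 (γ t)) := by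
  obtain ⟨u, htu, hfree⟩ := h.exists_Ioo_right_free t
  have hc : Continuous fun τ : ℝ => freeFlight G (τ - t) (γ t) := by
    have hff := continuous_freeFlight_of_continuous_translate hG (γ t)
    fun_prop
  have h1 : Tendsto (fun τ : ℝ => freeFlight G (τ - t) (γ t)) (𝓝[>] t) (𝓝 (γ t)) := by
    have := (hc.tendsto t).mono_left (nhdsWithin_le_nhds (s := Ioi t))
    simpa using this
  refine h1.congr' ?_
  filter_upwards [Ioo_mem_nhdsGT htu] with τ hτ
  exact (h.eq_freeFlight_of_Ioo_free hfree ⟨hτ.1.le, hτ.2⟩).symm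

/-- The left-limit function has right limits equal to the trajectory. [folklore] -/
theorem tendsto_leftLim_nhdsGT [T2Space X] (h : IsHardSphereTrajectory G ε N γ)
    (hG : ∀ x : X, Continuous (G.translate x)) (t : ℝ) :
    Tendsto (leftLim γ) (𝓝[>] t) (𝓝 (γ t)) := by
  obtain ⟨u, htu, hfree⟩ := h.exists_Ioo_right_free t
  have hc : Continuous fun τ : ℝ => freeFlight G (τ - t) (γ t) := by
    have hff := continuous_freeFlight_of_continuous_translate hG (γ t)
    fun_prop
  have h1 : Tendsto (fun τ : ℝ => freeFlight G (τ - t) (γ t)) (𝓝[>] t) (𝓝 (γ t)) := by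
    have := (hc.tendsto t).mono_left (nhdsWithin_le_nhds (s := Ioi t))
    simpa using this
  refine h1.congr' ?_
  filter_upwards [Ioo_mem_nhdsGT htu] with w hw
  exact (h.leftLim_eq_freeFlight hG hw.1 fun σ hσ => hfree σ ⟨hσ.1, hσ.2.trans hw.2⟩).symm

/-- The left-limit function is left-continuous. [folklore] -/
theorem tendsto_leftLim_nhdsLT [T2Space X] (h : IsHardSphereTrajectory G ε N γ)
    (hG : ∀ x : X, Continuous (G.translate x)) (t : ℝ) :
    Tendsto (leftLim γ) (𝓝[<] t) (𝓝 (leftLim γ t)) := by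
  obtain ⟨s, hst, hfree⟩ := h.exists_Ioo_left_free t
  rw [h.leftLim_eq_freeFlight hG hst hfree]
  have hc : Continuous fun τ : ℝ => freeFlight G (τ - s) (γ s) := by
    have hff := continuous_freeFlight_of_continuous_translate hG (γ s)
    fun_prop
  refine ((hc.tendsto t).mono_left nhdsWithin_le_nhds).congr' ?_
  filter_upwards [Ioo_mem_nhdsLT hst] with w hw
  exact (h.leftLim_eq_freeFlight hG hw.1 fun σ hσ => hfree σ ⟨hσ.1, hσ.2.trans hw.2⟩).symm

end IsHardSphereTrajectory

/-! ## Time reversal -/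

omit [Fintype d] in
/-- Unfolding lemma for the time reversal. [folklore] -/
theorem timeReverse_apply (γ : ℝ → Config N d X) (t : ℝ) :
    timeReverse γ t = flipVel (leftLim γ (-t)) := rfl

/-- The positions of the time reversal at `t` are those of the trajectory at `-t`. [folklore] -/
theorem IsHardSphereTrajectory.timeReverse_apply_fst [T2Space X] {G : Geometry d X} {ε : ℝ}
    {γ : ℝ → Config N d X} (h : IsHardSphereTrajectory G ε N γ)
    (hG : ∀ x : X, Continuous (G.translate x)) (t : ℝ) (i : Fin N) :
    (FluidPDE.timeReverse γ t i).1 = (γ (-t) i).1 := by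
  rw [timeReverse_apply, flipVel_apply]
  exact h.leftLim_apply_fst hG (-t) i

/-- The collision times of the time reversal are the negatives of the collision times. [folklore] -/
theorem IsHardSphereTrajectory.mem_collisionTimes_timeReverse [T2Space X] {G : Geometry d X}
    {ε : ℝ} {γ : ℝ → Config N d X} (h : IsHardSphereTrajectory G ε N γ)
    (hG : ∀ x : X, Continuous (G.translate x)) {t : ℝ} :
    t ∈ collisionTimes G ε (FluidPDE.timeReverse γ) ↔ -t ∈ collisionTimes G ε γ := by
  simp only [mem_collisionTimes, mem_contactSet_congr_fst (h.timeReverse_apply_fst hG t)]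

section TimeReverse

variable {G : Geometry d X} {ε : ℝ} {γ : ℝ → Config N d X}

/-- **Reversibility of the hard-sphere dynamics** (CIP 1994 §4.2, (2.3)): the time reversal
`t ↦ flipVel (leftLim γ (-t))` of a hard-sphere trajectory is a hard-sphere trajectory, for a
Hausdorff position space and continuous translations. Discharges the named fact
`IsHardSphereTrajectory.timeReverse`. Proof: positions and hence contact are read off `γ (-t)`;
on a reversed collision-free stretch the left limits are free-flight values and
`S_u ∘ S ∘ S_u = S`; at a reversed collision time the new left limit is the flip of the old
post-collisional value (right limits of `leftLim γ` are values of `γ`), which is incoming because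
the old one was outgoing (`isOutgoing_collidePair_iff`), and the new value `S zl` is its
reflection because the reflection commutes with `S` and is an involution. [cite: CIP1994, §4.2 (2.3)] -/
theorem IsHardSphereTrajectory.timeReverse_holds :
    IsHardSphereTrajectory.timeReverse (G := G) (ε := ε) (γ := γ) := by
  intro _ hG h
  have hpos : ∀ t i, (FluidPDE.timeReverse γ t i).1 = (γ (-t) i).1 := h.timeReverse_apply_fst hG
  have hcol : ∀ t, t ∈ collisionTimes G ε (FluidPDE.timeReverse γ) ↔ -t ∈ collisionTimes G ε γ :=
    fun t => h.mem_collisionTimes_timeReverse hG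
  refine ⟨fun t => ?_, fun a b => ?_, fun i => ?_, fun s t hst hfree => ?_,
    fun t i j hij hc => ?_⟩
  · -- stays in the domain
    exact (mem_hardSphereDomain_congr_fst (hpos t)).2 (h.mem (-t))
  · -- locally finitely many collision times
    have hset : collisionTimes G ε (FluidPDE.timeReverse γ) ∩ Icc a b =
        Neg.neg ⁻¹' (collisionTimes G ε γ ∩ Icc (-b) (-a)) := by
      ext t
      simp only [mem_inter_iff, hcol t, mem_Icc, mem_preimage, neg_le_neg_iff]
      tauto
    rw [hset]
    exact (h.locFinite (-b) (-a)).preimage neg_injective.injOn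
  · -- positions are continuous
    have hfun : (fun t => (FluidPDE.timeReverse γ t i).1) = fun t => (γ (-t) i).1 :=
      funext fun t => hpos t i
    rw [hfun]
    simpa only [Function.comp_def] using (h.pos_continuous i).comp continuous_neg
  · -- free flight on reversed collision-free stretches
    rcases hst.eq_or_lt with rfl | hst'
    · simp
    have hnt : -t ∉ collisionTimes G ε γ := fun hmem =>
      hfree t ⟨hst', le_rfl⟩ ((hcol t).2 hmem)
    have hfreeγ : ∀ σ ∈ Ioo (-t) (-s), σ ∉ collisionTimes G ε γ := fun σ hσ hmem =>
      hfree (-σ) ⟨by linarith [hσ.2], by linarith [hσ.1]⟩ ((hcol (-σ)).2 (by simpa using hmem))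
    have h1 : leftLim γ (-s) = freeFlight G (-s - -t) (γ (-t)) :=
      h.leftLim_eq_freeFlight hG (by linarith) hfreeγ
    have h2 : leftLim γ (-t) = γ (-t) := h.leftLim_eq_of_not_mem hG hnt
    rw [timeReverse_apply, timeReverse_apply, h1, h2, show -s - -t = t - s by ring,
      freeFlight_flipVel_freeFlight]
  · -- binary collisions
    have hcγ : γ (-t) ∈ contactSet G N ε i j := (mem_contactSet_congr_fst (hpos t)).1 hc
    obtain ⟨huniq, -⟩ := h.binary (-t) i j hij hcγ
    obtain ⟨hin, heq⟩ := h.eq_collidePair_leftLim hij hcγ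
    refine ⟨fun i' j' hij' hc' => huniq i' j' hij' ((mem_contactSet_congr_fst (hpos t)).1 hc'),
      flipVel (γ (-t)), ?_, ?_, ?_⟩
    · change Tendsto (fun t' => flipVel (leftLim γ (-t'))) (𝓝[<] t) (𝓝 (flipVel (γ (-t))))
      exact (continuous_flipVel.tendsto _).comp
        ((h.tendsto_leftLim_nhdsGT hG (-t)).comp tendsto_neg_nhdsLT)
    · rw [isIncoming_flipVel_iff, heq, isOutgoing_collidePair_iff hij]
      exact hin
    · rw [timeReverse_apply, collidePair_flipVel hij, heq, collidePair_collidePair hij]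

/-- **Reversibility of the hard-sphere dynamics**, namespace-level form of the discharge: the
named fact `IsHardSphereTrajectory.timeReverse` — the time reversal `FluidPDE.timeReverse γ`
(`t ↦ flipVel (leftLim γ (-t))`) of a hard-sphere trajectory is a hard-sphere trajectory, for a
Hausdorff position space and continuous translations — holds; this is CIP 1994 §4.2, eq. (2.3)
(`T^t S T^t = S`, i.e. `S T^t = T^{-t} S` on `Γ₀`) read trajectory-wise. It is the theorem
`IsHardSphereTrajectory.timeReverse_holds` above, recorded under the name of the reversal map
`FluidPDE.timeReverse` it concerns (so that `FluidPDE.timeReverse_holds` resolves).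
[cite: CIP1994, §4.2 (2.3)] -/
theorem timeReverse_holds :
    IsHardSphereTrajectory.timeReverse (G := G) (ε := ε) (γ := γ) :=
  IsHardSphereTrajectory.timeReverse_holds

end TimeReverse

end Topology

/-! ## Conservation of energy -/

section Energy

omit [Fintype d] in
/-- The kinetic energy only depends on the velocities. [folklore] -/
theorem configEnergy_congr_snd [Fintype d] {z z' : Config N d X} (h : ∀ i, (z i).2 = (z' i).2) :
    configEnergy z = configEnergy z' := by
  simp only [configEnergy, h]

variable [TopologicalSpace X] {G : Geometry d X} {ε : ℝ} {γ : ℝ → Config N d X}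

namespace IsHardSphereTrajectory

/-- On a hard-sphere trajectory the energy is constant to the right of every time: on a
collision-free stretch `[t, u)` the motion is free flight from `γ t`. [folklore] -/
theorem configEnergy_eq_of_mem_Ico (h : IsHardSphereTrajectory G ε N γ) {t u τ : ℝ}
    (hfree : ∀ σ ∈ Ioo t u, σ ∉ collisionTimes G ε γ) (hτ : τ ∈ Ico t u) :
    configEnergy (γ τ) = configEnergy (γ t) := by
  rw [h.eq_freeFlight_of_Ioo_free hfree hτ, configEnergy_freeFlight]

/-- On a hard-sphere trajectory the energy is constant to the left of every time: if `(τ, t)` is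
collision-free then either `t` is not a collision time and `γ t` is the free-flight value from
`γ τ`, or it is, and `γ t` is the elastic reflection (which preserves the energy,
`configEnergy_collidePair`) of the left limit, whose velocities are those of `γ τ` (velocities
are constant on `[τ, t)` and limits in `ℝ^d` are unique; no separation of the position space is
needed). [folklore] -/
theorem configEnergy_eq_of_Ioo_free (h : IsHardSphereTrajectory G ε N γ) {τ t : ℝ} (hτt : τ < t)
    (hfree : ∀ σ ∈ Ioo τ t, σ ∉ collisionTimes G ε γ) :
    configEnergy (γ t) = configEnergy (γ τ) := by
  by_cases ht : t ∈ collisionTimes G ε γ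
  · obtain ⟨i, j, hij, hc⟩ := ht
    obtain ⟨-, zl, hzl, -, heq⟩ := h.binary t i j hij hc
    rw [heq, configEnergy_collidePair hij]
    refine configEnergy_congr_snd fun k => ?_
    have h1 : Tendsto (fun σ => (γ σ k).2) (𝓝[<] t) (𝓝 (zl k).2) := by
      have hcont : Continuous fun z : Config N d X => (z k).2 := by fun_prop
      exact (hcont.tendsto zl).comp hzl
    have h2 : Tendsto (fun σ => (γ σ k).2) (𝓝[<] t) (𝓝 (γ τ k).2) := by
      refine tendsto_const_nhds.congr' ?_
      filter_upwards [Ioo_mem_nhdsLT hτt] with σ hσ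
      rw [h.eq_freeFlight_of_Ioo_free hfree ⟨hσ.1.le, hσ.2⟩]
      rfl
    exact tendsto_nhds_unique h1 h2
  · rw [h.free τ t hτt.le fun σ hσ => ?_, configEnergy_freeFlight]
    rcases hσ.2.eq_or_lt with rfl | hlt
    · exact ht
    · exact hfree σ ⟨hσ.1, hlt⟩

/-- The energy along a hard-sphere trajectory is a locally constant function of time (every time
has collision-free open intervals on both sides). [folklore] -/
theorem isLocallyConstant_configEnergy (h : IsHardSphereTrajectory G ε N γ) :
    IsLocallyConstant fun t => configEnergy (γ t) := by
  refine (IsLocallyConstant.iff_eventually_eq _).2 fun t => ?_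
  obtain ⟨s, hst, hfreel⟩ := h.exists_Ioo_left_free t
  obtain ⟨u, htu, hfreer⟩ := h.exists_Ioo_right_free t
  filter_upwards [Ioo_mem_nhds hst htu] with y hy
  rcases lt_or_ge y t with hyt | hty
  · exact (h.configEnergy_eq_of_Ioo_free hyt fun σ hσ => hfreel σ ⟨hy.1.trans hσ.1, hσ.2⟩).symm
  · exact h.configEnergy_eq_of_mem_Ico hfreer ⟨hty, hy.2⟩

/-- **Conservation of the kinetic energy along a hard-sphere trajectory** (GST 2013 §1.1; CIP
1994 §4.2): discharge of the named fact `IsHardSphereTrajectory.configEnergy_eq`. Free flight does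
not change the velocities and an elastic collision preserves `½ ∑ |v_i|²`
(`configEnergy_collidePair`); since collision times are locally finite the energy is a locally
constant function of time, hence constant, `ℝ` being connected. [cite: GST2013, §1.1] -/
theorem configEnergy_eq_holds :
    IsHardSphereTrajectory.configEnergy_eq (G := G) (ε := ε) (γ := γ) :=
  fun h s t => h.isLocallyConstant_configEnergy.apply_eq_of_preconnectedSpace s t

end IsHardSphereTrajectory

end Energy

/-! ## Transport of densities along the hard-sphere flow -/

section LawAt

open MeasureTheory

variable [MeasureSpace X] [TopologicalSpace X] {G : Geometry d X} {ε : ℝ}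

/-- Discharge of the named fact `HardSphereFlow.lawAt_withDensity` (mild Liouville equation,
GST 2013 §4.2 / Prop. 4.1.1; CIP 1994 §4.2): the law at time `t` of `W dZ` is `(W ∘ Φ_{-t}) dZ`.
Proof: for a measurable `s`, `((W dZ).map Φ_t)(s) = ∫_{Φ_t⁻¹ s} W dZ`, while by invariance of the
Liouville measure `dZ = (Φ_t)_* dZ` (`HardSphereFlow.measurePreserving`) one has
`∫_s W ∘ Φ_{-t} dZ = ∫_{Φ_t⁻¹ s} W (Φ_{-t} (Φ_t z)) dZ`, and `Φ_{-t} ∘ Φ_t = id` on the conull good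
set (`HardSphereFlow.flow_neg_flow`). [cite: GST2013, Prop. 4.1.1] -/
theorem HardSphereFlow.lawAt_withDensity_holds :
    HardSphereFlow.lawAt_withDensity (G := G) (ε := ε) (N := N) := by
  intro Φ W hW t
  ext s hs
  rw [HardSphereFlow.lawAt_eq, Measure.map_apply (Φ.measurable_flow t) hs,
    withDensity_apply _ ((Φ.measurable_flow t) hs), withDensity_apply _ hs]
  have hmeas : Measurable fun z => W (Φ.flow (-t) z) := hW.comp (Φ.measurable_flow (-t))
  calc ∫⁻ z in Φ.flow t ⁻¹' s, W z ∂liouville G N ε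
      = ∫⁻ z in Φ.flow t ⁻¹' s, W (Φ.flow (-t) (Φ.flow t z)) ∂liouville G N ε := by
        refine lintegral_congr_ae (ae_restrict_of_ae ?_)
        filter_upwards [Φ.ae_mem_good] with z hz
        rw [Φ.flow_neg_flow t hz]
    _ = ∫⁻ z in s, W (Φ.flow (-t) z) ∂(liouville G N ε).map (Φ.flow t) := by
        rw [setLIntegral_map hs hmeas (Φ.measurable_flow t)]
    _ = ∫⁻ z in s, Φ.transportDensity W t z ∂liouville G N ε := by
        rw [(Φ.measurePreserving t).map_eq]
        rfl

end LawAt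

end Kinetic

end

end Literature.Analysis.FluidPDE
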